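import Literature.AnabelianGeometry.SemiGraphs.ArithEstrangementOfLem55
import Mathlib.NumberTheory.Padics.RingHoms
import Mathlib.NumberTheory.Padics.ProperSpace
import HarnessLib

/-!
# [SemiAnbd] Ex 5.6 «immediately from Lemma 5.5» — NON-VACUITY of the reduction datum of
# `not_isArithAmple_inf_conj_of_lem55` (a `ℤ_p`-linear toy at which every binder holds and Lemma 5.5's shape is TRUE)

Mochizuki, *Semi-graphs of anabelioids*, Publ. RIMS **42** (2006): Def 5.3 (ii) p. 293, Lemma 5.5 p. 294,
Ex 5.6 p. 295 (PRIMS) [cite: MochizukiSemiAnbd2006, Ex 5.6, p. 67].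

PROOF-ONLY companion (cell abc-iut, layer L3, L-F pack B; seat abc-iut-w4-d059 gen 5) of
`ArithEstrangementOfLem55.lean` (p460908).  That file reduces the cross clause of Def 5.3 (ii) at a vertex
carrying a «reduction datum» to Lemma 5.5 = `DecompositionGroupsDetermineStatement` (F-1367) over every open
subgroup of `G_k`.  Because the Lemma-5.5 binder is stated on RESTRICTED data (`augX.subgroupComap H`,
cod-restricted sections), a kernel check that the whole hypothesis list is JOINTLY SATISFIABLE — with two distinct
branches present and the Lemma-5.5 binder TRUE rather than vacuous — is worth having (cell rule C-R33: no
conditional theorem with an unwitnessed antecedent).  THIS FILE supplies it at the smallest honest toy (all data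
written INLINE — no definition is introduced):

* `G_k := ℤ_p` (written multiplicatively; compact, Frobenius `F := 1` topologically generates: `ℤ` is dense);
* `Π_X := ℤ_p × ℤ_p` with `augX := pr₁`, points `Pts := ℤ_p` («slopes») with sections `σ_λ : s ↦ (s, λ s)`,
  i.e. `σ_λ := toMultiplicative (id.prod (mulLeft λ))`;
* Lemma 5.5's shape HOLDS for these data over every open `H ≤ ℤ_p` (`decompositionGroupsDetermine_toy`):
  `Π_X` is abelian, so conjugate sections are equal on `H`; an open subgroup of `ℤ_p` contains some `pⁿ ≠ 0`,
  and `λ pⁿ = μ pⁿ` forces `λ = μ` (`ℤ_p` is a domain);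
* the decomposition datum: ONE vertex with `Π_{𝔊,v} := Π_X` (so `red := ⊤.subtype`), TWO branches `b₀ ≠ b₁`
  (`Bool`) with `Π_{𝔊,b} := range σ_{slope b}` (slopes `0` and `1`), `augk := augX`.

`not_isArithAmple_inf_conj_toy` then FIRES `not_isArithAmple_inf_conj_of_lem55` at these data: for every `g`,
`range σ₀ ∩ g·(range σ₁)·g⁻¹` is not arithmetically ample for `pr₁` (indeed it is `{0}`, whose image `{0} ⊂ ℤ_p`
is not open) — every binder of p460908 discharged at one datum, none vacuously.  A toy certifies CONSISTENCY of
the binder shapes only; it is not a model of any genuine datum of Ex 5.6 (no curve, no finite field); witnessed ≠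
endorsed; nothing here bears on [IUTchIII] Cor. 3.12; no side taken.
-/

noncomputable section

namespace Literature.AnabelianGeometry.SemiGraphs

namespace Lem55Toy

open Topology Multiplicative

variable (p : ℕ) [hp : Fact p.Prime]

/-- The toy sections `σ_λ : s ↦ (s, λ s)` are sections of the toy augmentation `pr₁`.
[cite: MochizukiSemiAnbd2006, Ex 5.6, p. 67] -/
theorem augX_comp_σ (l : ℤ_[p]) :
    (AddMonoidHom.toMultiplicative (AddMonoidHom.fst ℤ_[p] ℤ_[p])).comp
        (AddMonoidHom.toMultiplicative ((AddMonoidHom.id ℤ_[p]).prod (AddMonoidHom.mulLeft l))) =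
      MonoidHom.id _ := by
  ext s; rfl

/-- The toy sections are continuous. [cite: MochizukiSemiAnbd2006, Ex 5.6, p. 67] -/
theorem continuous_σ (l : ℤ_[p]) :
    Continuous (AddMonoidHom.toMultiplicative ((AddMonoidHom.id ℤ_[p]).prod (AddMonoidHom.mulLeft l))) :=
  continuous_ofAdd.comp ((continuous_id.prodMk (continuous_const.mul continuous_id)).comp continuous_toAdd)

/-- `ℤ` is dense in `ℤ_p`: Frobenius `F := 1` topologically generates the toy `G_k`.
[cite: MochizukiSemiAnbd2006, Ex 5.6, p. 67] -/
theorem dense_zpowers_one :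
    Dense ((Subgroup.zpowers (ofAdd (1 : ℤ_[p])) : Subgroup (Multiplicative ℤ_[p])) :
      Set (Multiplicative ℤ_[p])) := by
  have h1 : ((Subgroup.zpowers (ofAdd (1 : ℤ_[p])) : Subgroup (Multiplicative ℤ_[p])) :
      Set (Multiplicative ℤ_[p])) = Set.range (fun m : ℤ => ofAdd ((m : ℤ_[p]))) := by
    ext t
    simp only [SetLike.mem_coe, Subgroup.mem_zpowers_iff, Set.mem_range, ← ofAdd_zsmul, zsmul_one]
  rw [h1]
  exact (DenseRange.comp ofAdd.surjective.denseRange (PadicInt.denseRange_intCast (p := p)) continuous_ofAdd :)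

/-- An open subgroup of the toy `G_k = ℤ_p` contains some `pⁿ` (a ball around `0` does).
[cite: MochizukiSemiAnbd2006, Ex 5.6, p. 67] -/
theorem exists_pow_mem_of_isOpen (H : Subgroup (Multiplicative ℤ_[p]))
    (hH : IsOpen (H : Set (Multiplicative ℤ_[p]))) : ∃ n : ℕ, ofAdd ((p : ℤ_[p]) ^ n) ∈ H := by
  have h0 : (ofAdd (0 : ℤ_[p]) : Multiplicative ℤ_[p]) ∈ (H : Set (Multiplicative ℤ_[p])) := by
    rw [ofAdd_zero]; exact H.one_mem
  have hH' : IsOpen (ofAdd ⁻¹' (H : Set (Multiplicative ℤ_[p])) : Set ℤ_[p]) := hH.preimage continuous_ofAdd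
  rcases Metric.isOpen_iff.mp hH' 0 h0 with ⟨ε, hε, hball⟩
  obtain ⟨n, hn⟩ := PadicInt.exists_pow_neg_lt p hε
  have hmem : ((p : ℤ_[p]) ^ n) ∈ Metric.ball (0 : ℤ_[p]) ε := by
    rw [Metric.mem_ball, dist_zero_right, PadicInt.norm_p_pow]
    exact hn
  exact ⟨n, hball hmem⟩

/-- **Lemma 5.5's SHAPE is TRUE at the toy**, over every open `H ≤ ℤ_p`: two toy sections `σ_λ`, `σ_μ` that are
conjugate on `H` (as cod-restricted sections of the restricted augmentation, exactly the binder shape of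
`not_isArithAmple_inf_conj_of_lem55`) have the same slope (`Π_X` abelian ⇒ equal on `H` ∋ `pⁿ ≠ 0` ⇒
`λ pⁿ = μ pⁿ` ⇒ `λ = μ`). [cite: MochizukiSemiAnbd2006, Lem 5.5, p. 66] -/
theorem decompositionGroupsDetermine_toy (H : Subgroup (Multiplicative ℤ_[p]))
    (hH : IsOpen (H : Set (Multiplicative ℤ_[p])))
    (hx : ∀ (l : ℤ_[p]) (s : H),
      AddMonoidHom.toMultiplicative ((AddMonoidHom.id ℤ_[p]).prod (AddMonoidHom.mulLeft l)) s ∈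
        H.comap (AddMonoidHom.toMultiplicative (AddMonoidHom.fst ℤ_[p] ℤ_[p]))) :
    DecompositionGroupsDetermineStatement
      ((AddMonoidHom.toMultiplicative (AddMonoidHom.fst ℤ_[p] ℤ_[p])).subgroupComap H)
      (fun l => ((AddMonoidHom.toMultiplicative ((AddMonoidHom.id ℤ_[p]).prod (AddMonoidHom.mulLeft l))).comp
        H.subtype).codRestrict (H.comap (AddMonoidHom.toMultiplicative (AddMonoidHom.fst ℤ_[p] ℤ_[p])))
        (fun s => hx l s)) := by
  intro _ l m ⟨q, hq⟩
  obtain ⟨n, hn⟩ := exists_pow_mem_of_isOpen p H hH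
  have h := congrArg (fun z : H.comap (AddMonoidHom.toMultiplicative (AddMonoidHom.fst ℤ_[p] ℤ_[p])) =>
    (toAdd (z : Multiplicative (ℤ_[p] × ℤ_[p]))).2) (hq ⟨_, hn⟩)
  simp only [MonoidHom.codRestrict_apply, MonoidHom.coe_comp, Subgroup.coe_subtype, Function.comp_apply,
    mul_inv_cancel_comm, toAdd_ofAdd, AddMonoidHom.toMultiplicative_apply_apply,
    AddMonoidHom.prod_apply, AddMonoidHom.id_apply, AddMonoidHom.coe_mulLeft] at h
  have hpn : ((p : ℤ_[p]) ^ n) ≠ 0 := pow_ne_zero n (by exact_mod_cast hp.out.ne_zero)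
  exact (mul_right_cancel₀ hpn h).symm

end Lem55Toy

open Topology Multiplicative

/-- **NON-VACUITY of p460908's reduction datum**: `not_isArithAmple_inf_conj_of_lem55` FIRES at the toy
decomposition datum (one vertex `Π_{𝔊,v} := ℤ_p × ℤ_p`, two branches `Π_{𝔊,b₀} := range σ₀`, `Π_{𝔊,b₁} := range σ₁`,
`augk := pr₁`, `red := ⊤.subtype`, points = slopes `0 ≠ 1`, Frobenius `1 ∈ ℤ_p`, Lemma 5.5 over every open
subgroup by `Lem55Toy.decompositionGroupsDetermine_toy`) — every binder discharged at one datum, and the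
conclusion reads: for every `g`, `range σ₀ ∩ g·(range σ₁)·g⁻¹` is not arithmetically ample for `pr₁ : ℤ_p² → ℤ_p`.
[cite: MochizukiSemiAnbd2006, Ex 5.6, p. 67] -/
theorem not_isArithAmple_inf_conj_toy (p : ℕ) [hp : Fact p.Prime] (g : Multiplicative (ℤ_[p] × ℤ_[p])) :
    ¬ IsArithAmple (AddMonoidHom.toMultiplicative (AddMonoidHom.fst ℤ_[p] ℤ_[p]))
      ((AddMonoidHom.toMultiplicative ((AddMonoidHom.id ℤ_[p]).prod (AddMonoidHom.mulLeft 0))).range ⊓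
        conjSubgroup g
          (AddMonoidHom.toMultiplicative ((AddMonoidHom.id ℤ_[p]).prod (AddMonoidHom.mulLeft 1))).range) := by
  haveI : CompactSpace (Multiplicative ℤ_[p]) := inferInstanceAs (CompactSpace ℤ_[p])
  haveI : T2Space (Multiplicative (ℤ_[p] × ℤ_[p])) := inferInstanceAs (T2Space (ℤ_[p] × ℤ_[p]))
  -- the toy decomposition datum, inline
  let D : DecompositionData (Multiplicative (ℤ_[p] × ℤ_[p])) Unit Bool :=
    { E := Unit
      edgeOf := fun _ => ()
      abut := fun _ => some ()
      vertGp := fun _ => ⊤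
      brGp := fun b => (AddMonoidHom.toMultiplicative
        ((AddMonoidHom.id ℤ_[p]).prod (AddMonoidHom.mulLeft (if b then (1 : ℤ_[p]) else 0)))).range
      brGp_le_vertGp := fun _ _ _ => le_top }
  have key := not_isArithAmple_inf_conj_of_lem55 D (AddMonoidHom.toMultiplicative (AddMonoidHom.fst ℤ_[p] ℤ_[p]))
    () (⊤ : Subgroup _).subtype (AddMonoidHom.toMultiplicative (AddMonoidHom.fst ℤ_[p] ℤ_[p])) (fun _ => rfl)
    (fun l : ℤ_[p] => AddMonoidHom.toMultiplicative ((AddMonoidHom.id ℤ_[p]).prod (AddMonoidHom.mulLeft l)))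
    (Lem55Toy.augX_comp_σ p) (Lem55Toy.continuous_σ p) (fun b : Bool => if b then (1 : ℤ_[p]) else 0)
    (fun b _ h hh => by simpa [D] using hh)
    (by
      -- distinct branches carry distinct points: slopes `0 ≠ 1`
      intro b b' _ _ hbb
      cases b <;> cases b' <;> first | rfl | (exfalso; simp at hbb))
    (ofAdd (1 : ℤ_[p])) (Lem55Toy.dense_zpowers_one p)
    (fun H hH hx => Lem55Toy.decompositionGroupsDetermine_toy p H hH hx)
    (b := false) (b' := true) rfl rfl (by decide) (Subgroup.mem_top g)
  simpa [D] using key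

end Literature.AnabelianGeometry.SemiGraphs
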